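import Literature.NumberTheory.EllipticCurves.ShintaniLatticeAction
import Mathlib.GroupTheory.Archimedean
import Mathlib.RingTheory.Coprime.Lemmas
import HarnessLib

/-!
# Null vectors of `L♮`: moving the double root to `∞`, and their stabilisers in `Γ₀(64)⁺`

[[cite: Shintani1975, §2, proof of Prop. 2.3 (p. 103)]] — "assume `(x, x) = 0`, `x ≠ 0`.  There
exists a `γ ∈ SL(2, ℤ)` which satisfies `ρ(γ) x = (s, 0, 0)` … `γ Γ_x γ⁻¹ = {±n(mN)}`": the orbit of
a non-zero NULL lattice vector in the unfolding of Shintani's lift has a unipotent stabiliser,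
conjugate to a group of integer translations.  For the twisted lift on `Γ = Γ₀(64)⁺`
(`Gamma0FundamentalDomain`, `ShintaniLatticeAction`) we PROVE:

* `trace_ne_neg_two` — `Γ₀(64)⁺` has no element of trace `-2` (a `2`-adic parity argument using
  `16 ∣ c`, `a ≡ d ≡ 1 (4)`), so `-`parabolic elements do not occur;
* `actV_Y2_eq_iff` — the stabiliser of `λY²` (`λ ≠ 0`) in entries: `c = 0 ∧ d² = 1`;
  `eq_T_zpow_of_c_eq_zero`, `eq_neg_T_zpow_of_c_eq_zero` (`c = 0 ⇒ γ = T^b` or `-T^{-b}`);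
* `exists_conj_to_yTwo` — **moving the double root to `∞`**: for null `k ≠ 0` there are
  `σ ∈ SL₂(ℤ)`, `λ ≠ 0` with `ι♮(k) ∘ σ⁻¹ = λ Y²` (Bezout on the rational root);
* `smul_eq_iff_exists_T_zpow` — then `γ • k = k` iff `σγσ⁻¹ = T^j` for some `j`;
* `jSubgroup σ = {j : σ⁻¹T^jσ ∈ Γ} = n₀ℤ` with `n₀ > 0` (finite index, `Int.subgroup_cyclic`);
* **`null_stabilizer`** — the package used by the unfolding: `σ`, `λ ≠ 0`, `n₀ > 0` and a
  bijection `m : Γ_k → ℤ` with `σ(γw) = (n₀ m(γ)) +ᵥ σw` for all `γ ∈ Γ_k`, and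
  `σ⁻¹T^{n₀}σ ∈ Γ` (so the strip `σ⁻¹ • {0 ≤ Re < n₀}` is a fundamental domain for `Γ_k`,
  `StripFundamentalDomain`, and the translate `φ|σ⁻¹` is `n₀`-periodic).

No named facts; the definitions are `yTwo` (`λY²`), `actM` and `jSubgroup`.
-/

noncomputable section

open scoped MatrixGroups
open UpperHalfPlane hiding I
open Complex CongruenceSubgroup
open Literature.NumberTheory.EllipticCurves.ModularForms

namespace Literature.NumberTheory.EllipticCurves.Shintani

/-! ### A. Matrix algebra -/

/-- **No `-`parabolic elements in `Γ₀(64)⁺`**: an element of `Γ₀(64) ∩ Γ₁(4)` cannot have trace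
`-2` (write `a = 1 + 4s`, `d = 1 + 4t`; then `bc = 4(4st - 1)` with `4st - 1` odd, impossible for
`16 ∣ c`). [folklore] -/
theorem trace_ne_neg_two (γ : Gamma0Plus 64) : ((γ : SL(2, ℤ)) 0 0 : ℤ) + (γ : SL(2, ℤ)) 1 1 ≠ -2 := by
  intro htr
  obtain ⟨h0, h1⟩ := Subgroup.mem_inf.mp γ.2
  rw [Gamma1_mem] at h1
  obtain ⟨ha, hd, _⟩ := h1
  have hc := sixtyfour_mul_cq γ
  have hdet := det_eq_one' (γ : SL(2, ℤ))
  -- `a ≡ 1`, `d ≡ 1 (mod 4)`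
  have ha' : ((γ : SL(2, ℤ)) 0 0 : ℤ) % 4 = 1 := by
    have := (ZMod.intCast_eq_intCast_iff' ((γ : SL(2, ℤ)) 0 0 : ℤ) 1 4).mp (by rw [ha]; simp)
    simpa using this
  have hd' : ((γ : SL(2, ℤ)) 1 1 : ℤ) % 4 = 1 := by
    have := (ZMod.intCast_eq_intCast_iff' ((γ : SL(2, ℤ)) 1 1 : ℤ) 1 4).mp (by rw [hd]; simp)
    simpa using this
  obtain ⟨s, hs⟩ : ∃ s : ℤ, ((γ : SL(2, ℤ)) 0 0 : ℤ) = 1 + 4 * s := ⟨((γ : SL(2, ℤ)) 0 0 : ℤ) / 4, by omega⟩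
  obtain ⟨t, ht⟩ : ∃ t : ℤ, ((γ : SL(2, ℤ)) 1 1 : ℤ) = 1 + 4 * t := ⟨((γ : SL(2, ℤ)) 1 1 : ℤ) / 4, by omega⟩
  -- `bc = 16 st - 4` and `c = 64 cq`
  have had : ((γ : SL(2, ℤ)) 0 0 : ℤ) * (γ : SL(2, ℤ)) 1 1 = 1 + 4 * s + 4 * t + 16 * (s * t) := by
    rw [hs, ht]; ring
  have hst : s + t = -1 := by omega
  have hbc : 64 * (((γ : SL(2, ℤ)) 0 1 : ℤ) * cq γ) = 16 * (s * t) - 4 := by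
    have : ((γ : SL(2, ℤ)) 0 1 : ℤ) * (γ : SL(2, ℤ)) 1 0 = 4 * s + 4 * t + 16 * (s * t) := by
      linarith [hdet, had]
    rw [← hc] at this
    linarith
  -- parity contradiction: `64 (b cq) = 16 (st) - 4`
  generalize ((γ : SL(2, ℤ)) 0 1 : ℤ) * cq γ = X at hbc
  generalize s * t = Y at hbc
  omega

/-- The coordinates of `actV` on the form `lam Y²`. [folklore] -/
theorem actV_Y2 (a b c d lam : ℝ) :
    actV a b c d (!₂[0, 0, lam]) = !₂[lam * c ^ 2, 2 * lam * c * d, lam * d ^ 2] := by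
  ext i
  fin_cases i <;> simp [actV]

/-- **The stabiliser of `lam Y²` (`lam ≠ 0`) in terms of entries**: `(lamY²) ∘ (a b; c d) = lam Y²` iff
`c = 0` and `d² = 1`. [folklore] -/
theorem actV_Y2_eq_iff {a b c d lam : ℝ} (hlam : lam ≠ 0) :
    actV a b c d (!₂[0, 0, lam]) = !₂[0, 0, lam] ↔ c = 0 ∧ d ^ 2 = 1 := by
  rw [actV_Y2]
  constructor
  · intro h
    have h0 := congrFun (congrArg (fun v : V ↦ (v : Fin 3 → ℝ)) h) 0
    have h2 := congrFun (congrArg (fun v : V ↦ (v : Fin 3 → ℝ)) h) 2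
    simp at h0 h2
    have hc : c = 0 := by
      rcases h0 with h0 | h0
      · exact absurd h0 hlam
      · exact h0
    refine ⟨hc, ?_⟩
    have : lam * (d ^ 2 - 1) = 0 := by linarith
    rcases mul_eq_zero.mp this with h | h
    · exact absurd h hlam
    · linarith
  · rintro ⟨hc, hd⟩
    rw [hc, hd]
    ext i
    fin_cases i <;> simp

/-- An element of `SL₂(ℤ)` with `c = 0` is `± T^{±b}`: precisely `d = 1 → γ = T^b` and
`d = -1 → γ = -T^{-b}`. [folklore] -/
theorem eq_T_zpow_of_c_eq_zero {γ : SL(2, ℤ)} (hc : (γ 1 0 : ℤ) = 0) (hd : (γ 1 1 : ℤ) = 1) :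
    γ = ModularGroup.T ^ (γ 0 1 : ℤ) := by
  have hdet := det_eq_one' γ
  rw [hc, hd, mul_zero, sub_zero, mul_one] at hdet
  ext i j
  rw [ModularGroup.coe_T_zpow]
  fin_cases i <;> fin_cases j <;> simp [hc, hd, hdet]

/-- The companion case `d = -1`: `γ = -T^{-b}`. [folklore] -/
theorem eq_neg_T_zpow_of_c_eq_zero {γ : SL(2, ℤ)} (hc : (γ 1 0 : ℤ) = 0) (hd : (γ 1 1 : ℤ) = -1) :
    γ = -ModularGroup.T ^ (-(γ 0 1 : ℤ)) := by
  have hdet := det_eq_one' γ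
  rw [hc, hd, mul_zero, sub_zero, mul_neg, mul_one, neg_eq_iff_eq_neg] at hdet
  ext i j
  rw [Matrix.SpecialLinearGroup.coe_neg, ModularGroup.coe_T_zpow]
  fin_cases i <;> fin_cases j <;> simp [hc, hd, hdet]

/-! ### B. Moving the double root of a null vector to `∞` -/

/-- The vector `(0, 0, lam) ∈ V` (the form `lam Y²`). [folklore] -/
def yTwo (lam : ℝ) : V := !₂[0, 0, lam]

/-- `ι♮(k)` is null iff `k₁² = 256 k₀ k₂`. [folklore] -/
theorem disc_latSharp_eq_zero_iff (k : Fin 3 → ℤ) :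
    disc (latSharp k) = 0 ↔ (k 1 : ℤ) ^ 2 = 256 * k 0 * k 2 := by
  rw [disc, latSharp_zero, latSharp_one, latSharp_two]
  constructor
  · intro h
    have : ((k 1 : ℤ) : ℝ) ^ 2 = 256 * (k 0 : ℤ) * (k 2 : ℤ) := by linarith
    exact_mod_cast this
  · intro h
    have : ((k 1 : ℤ) : ℝ) ^ 2 = 256 * (k 0 : ℤ) * (k 2 : ℤ) := by exact_mod_cast h
    linarith

/-- **Moving the double root to `∞`**: for a non-zero null `k` there are `σ ∈ SL₂(ℤ)` and `lam ≠ 0`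
with `ι♮(k) ∘ σ⁻¹ = lam Y²` (as `actV` with the entries of `σ⁻¹`). [folklore] -/
theorem exists_conj_to_yTwo {k : Fin 3 → ℤ} (hnull : disc (latSharp k) = 0) (hk : k ≠ 0) :
    ∃ (σ : SL(2, ℤ)) (lam : ℝ), lam ≠ 0 ∧
      actV ((σ⁻¹) 0 0 : ℤ) ((σ⁻¹) 0 1 : ℤ) ((σ⁻¹) 1 0 : ℤ) ((σ⁻¹) 1 1 : ℤ) (latSharp k) = yTwo lam := by
  rw [disc_latSharp_eq_zero_iff] at hnull
  by_cases hk0 : k 0 = 0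
  · -- then `k₁ = 0` and `k = (0, 0, k₂)`: `σ = 1`
    have hk1 : k 1 = 0 := by
      rw [hk0] at hnull; simpa using hnull
    have hk2 : k 2 ≠ 0 := by
      intro h2; apply hk; ext i; fin_cases i <;> simp [hk0, hk1, h2]
    refine ⟨1, k 2, by exact_mod_cast hk2, ?_⟩
    have h1 : ((1 : SL(2, ℤ))⁻¹) = 1 := inv_one
    rw [h1]
    simp only [Matrix.SpecialLinearGroup.coe_one, Matrix.one_apply_eq, ne_eq, one_ne_zero,
      not_false_eq_true, Matrix.one_apply_ne, zero_ne_one, Int.cast_one, Int.cast_zero]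
    rw [actV_id]
    ext i; fin_cases i <;> simp [latSharp, yTwo, hk0, hk1]
  · -- `ρ = -k₁/(128 k₀) = p/q` in lowest terms; `σ = (u v; -q p)` with `u p + v q = 1`
    have hg : 0 < Int.gcd (-k 1) (128 * k 0) := by
      rw [Int.gcd_pos_iff]; right; simpa using hk0
    obtain ⟨g, p, q, hgpos, hcop, hp, hq⟩ := Int.exists_gcd_one' hg
    have hq0 : q ≠ 0 := by
      intro h; rw [h, zero_mul] at hq; simp at hq; exact hk0 hq
    obtain ⟨u, v, huv⟩ : ∃ u v : ℤ, u * p + v * q = 1 := by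
      have := Int.isCoprime_iff_gcd_eq_one.mpr hcop
      obtain ⟨u, v, h⟩ := this
      exact ⟨u, v, by linarith [h]⟩
    -- the matrix `σ = (u v; -q p)`
    let σ : SL(2, ℤ) := ⟨!![u, v; -q, p], by
      rw [Matrix.det_fin_two_of]; linarith⟩
    refine ⟨σ, (64 * k 0 : ℝ) / (q : ℝ) ^ 2, ?_, ?_⟩
    · have : (q : ℝ) ≠ 0 := by exact_mod_cast hq0
      have : (k 0 : ℝ) ≠ 0 := by exact_mod_cast hk0
      positivity
    · -- entries of `σ⁻¹ = (p -v; q u)`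
      have h00 : ((σ⁻¹) 0 0 : ℤ) = p := by rw [Matrix.SpecialLinearGroup.SL2_inv_expl]; rfl
      have h01 : ((σ⁻¹) 0 1 : ℤ) = -v := by rw [Matrix.SpecialLinearGroup.SL2_inv_expl]; rfl
      have h10 : ((σ⁻¹) 1 0 : ℤ) = q := by
        rw [Matrix.SpecialLinearGroup.SL2_inv_expl]
        show -(-q) = q; ring
      have h11 : ((σ⁻¹) 1 1 : ℤ) = u := by rw [Matrix.SpecialLinearGroup.SL2_inv_expl]; rfl
      rw [h00, h01, h10, h11]
      -- the root relation `128 k₀ p = -k₁ q` (from `p g = -k₁`, `q g = 128 k₀`)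
      have hroot : 128 * (k 0 : ℝ) * p + (k 1 : ℝ) * q = 0 := by
        have h1 : (128 * k 0 * p + k 1 * q : ℤ) * g = 0 := by
          have e1 : p * (g : ℤ) = -k 1 := hp.symm
          have e2 : q * (g : ℤ) = 128 * k 0 := hq.symm
          linear_combination (128 * k 0) * e1 + (k 1) * e2
        have hg0 : (g : ℤ) ≠ 0 := by exact_mod_cast hgpos.ne'
        have : (128 * k 0 * p + k 1 * q : ℤ) = 0 := by
          rcases mul_eq_zero.mp h1 with h | h
          · exact h
          · exact absurd h hg0
        exact_mod_cast this
      have hnullR : ((k 1 : ℤ) : ℝ) ^ 2 = 256 * (k 0 : ℤ) * (k 2 : ℤ) := by exact_mod_cast hnull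
      have huvR : (u : ℝ) * p + v * q = 1 := by exact_mod_cast huv
      have hqR : (q : ℝ) ≠ 0 := by exact_mod_cast hq0
      have hk0R : ((k 0 : ℤ) : ℝ) ≠ 0 := by exact_mod_cast hk0
      -- with `A = 64k₀`, `B = k₁`, `C = k₂`: `2Ap + Bq = 0` and `B² = 4AC`
      set A : ℝ := 64 * (k 0 : ℤ) with hA
      set B : ℝ := ((k 1 : ℤ) : ℝ) with hB
      set C : ℝ := ((k 2 : ℤ) : ℝ) with hC
      have hA0 : A ≠ 0 := by rw [hA]; positivity
      have hr : 2 * A * p + B * q = 0 := by rw [hA, hB]; linarith [hroot]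
      have hd : B ^ 2 - 4 * A * C = 0 := by rw [hA, hB, hC]; linarith
      -- the three coordinates of `x ∘ σ⁻¹`
      have hx : latSharp k = !₂[A, B, C] := by
        ext i; fin_cases i <;> simp [latSharp, hA, hB, hC]
      rw [hx, yTwo]
      have e0 : A * (p : ℝ) ^ 2 + B * p * q + C * (q : ℝ) ^ 2 = 0 := by
        have h4 : 4 * A * (A * (p : ℝ) ^ 2 + B * p * q + C * (q : ℝ) ^ 2) =
            (2 * A * p + B * q) ^ 2 - (B ^ 2 - 4 * A * C) * q ^ 2 := by ring
        rw [hr, hd] at h4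
        have : 4 * A * (A * (p : ℝ) ^ 2 + B * p * q + C * (q : ℝ) ^ 2) = 0 := by rw [h4]; ring
        rcases mul_eq_zero.mp this with h | h
        · exact absurd (by linarith : A = 0) hA0
        · exact h
      have e1' : B * p + 2 * C * q = 0 := by
        have h2 : 2 * A * (B * p + 2 * C * q) = B * (2 * A * p + B * q) - (B ^ 2 - 4 * A * C) * q := by ring
        rw [hr, hd] at h2
        have : 2 * A * (B * p + 2 * C * q) = 0 := by rw [h2]; ring
        rcases mul_eq_zero.mp this with h | h
        · exact absurd (by linarith : A = 0) hA0
        · exact h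
      have e1 : 2 * A * p * (-v : ℝ) + B * (p * u + (-v) * q) + 2 * C * q * u = 0 := by
        have : 2 * A * p * (-v : ℝ) + B * (p * u + (-v) * q) + 2 * C * q * u =
            u * (B * p + 2 * C * q) - v * (2 * A * p + B * q) := by ring
        rw [this, e1', hr]; ring
      have e2 : A * (-v : ℝ) ^ 2 + B * (-v) * u + C * (u : ℝ) ^ 2 = A / (q : ℝ) ^ 2 := by
        have hE : 4 * A * ((q : ℝ) ^ 2 * (A * (-v : ℝ) ^ 2 + B * (-v) * u + C * (u : ℝ) ^ 2) -
            A * (u * p + v * q) ^ 2) =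
            -4 * A * u * v * q * (B * q + 2 * A * p) + u ^ 2 * (4 * A * C - B ^ 2) * q ^ 2 +
              u ^ 2 * (B * q - 2 * A * p) * (B * q + 2 * A * p) := by ring
        have hr' : B * q + 2 * A * p = 0 := by linarith
        have hd' : 4 * A * C - B ^ 2 = 0 := by linarith
        rw [hr', hd', huvR] at hE
        have : (q : ℝ) ^ 2 * (A * (-v : ℝ) ^ 2 + B * (-v) * u + C * (u : ℝ) ^ 2) - A * 1 ^ 2 = 0 := by
          have h0 : 4 * A * ((q : ℝ) ^ 2 * (A * (-v : ℝ) ^ 2 + B * (-v) * u + C * (u : ℝ) ^ 2) - A * 1 ^ 2) = 0 := by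
            rw [hE]; ring
          rcases mul_eq_zero.mp h0 with h | h
          · exact absurd (by linarith : A = 0) hA0
          · exact h
        field_simp
        linarith
      ext i
      fin_cases i
      · simp [actV]; linarith [e0]
      · simp [actV]; linarith [e1]
      · simp [actV]; linarith [e2]

end Literature.NumberTheory.EllipticCurves.Shintani

namespace Literature.NumberTheory.EllipticCurves.Shintani

open scoped MatrixGroups
open Literature.NumberTheory.EllipticCurves.ModularForms CongruenceSubgroup

/-! ### C. The stabiliser of a null vector in `Γ₀(64)⁺` -/

/-- `actV` by the entries of a matrix of `SL₂(ℤ)` (the right action `x ↦ x ∘ g`). [folklore] -/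
def actM (g : SL(2, ℤ)) (x : V) : V := actV (g 0 0 : ℤ) (g 0 1 : ℤ) (g 1 0 : ℤ) (g 1 1 : ℤ) x

/-- `actM` is a right action: `actM h (actM g x) = actM (g h) x`. [folklore] -/
theorem actM_actM (g h : SL(2, ℤ)) (x : V) : actM h (actM g x) = actM (g * h) x := by
  unfold actM
  rw [actV_actV]
  have e : ∀ i j, ((g * h) i j : ℤ) = g i 0 * h 0 j + g i 1 * h 1 j := by
    intro i j; simp [Matrix.mul_apply, Fin.sum_univ_two]
  rw [e 0 0, e 0 1, e 1 0, e 1 1]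
  push_cast
  ring_nf

/-- `actM 1 = id`. [folklore] -/
theorem actM_one (x : V) : actM 1 x = x := by
  unfold actM; simpa using actV_id x

/-- `ι♮(γ • k) = actM γ⁻¹ (ι♮ k)`. [folklore] -/
theorem latSharp_smul_eq_actM (γ : Gamma0Plus 64) (k : Fin 3 → ℤ) :
    latSharp (γ • k) = actM ((γ : SL(2, ℤ))⁻¹) (latSharp k) := by
  obtain ⟨h00, h01, h10, h11⟩ := inv_apply (γ : SL(2, ℤ))
  rw [latSharp_smul, actM, h00, h01, h10, h11]

/-- The trace is a conjugation invariant (entries). [folklore] -/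
theorem trace_conj (σ γ : SL(2, ℤ)) :
    ((σ * γ * σ⁻¹) 0 0 : ℤ) + (σ * γ * σ⁻¹) 1 1 = γ 0 0 + γ 1 1 := by
  obtain ⟨i00, i01, i10, i11⟩ := inv_apply σ
  have e : ∀ i j, ((σ * γ * σ⁻¹) i j : ℤ) =
      (σ i 0 * γ 0 0 + σ i 1 * γ 1 0) * (σ⁻¹) 0 j + (σ i 0 * γ 0 1 + σ i 1 * γ 1 1) * (σ⁻¹) 1 j := by
    intro i j; simp [Matrix.mul_apply, Fin.sum_univ_two]
  rw [e 0 0, e 1 1, i00, i01, i10, i11]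
  linear_combination ((γ 0 0 : ℤ) + γ 1 1) * det_eq_one' σ

variable {k : Fin 3 → ℤ}

/-- **The stabiliser condition transported by `σ`**: if `ι♮(k) ∘ σ⁻¹ = λY²` (`λ ≠ 0`) then
`γ • k = k` iff `τ = σγσ⁻¹` has `c = 0` and `d² = 1`. [folklore] -/
theorem smul_eq_iff_conj {σ : SL(2, ℤ)} {lam : ℝ} (hlam : lam ≠ 0)
    (hσ : actM σ⁻¹ (latSharp k) = yTwo lam) (γ : Gamma0Plus 64) :
    γ • k = k ↔ ((σ * (γ : SL(2, ℤ)) * σ⁻¹) 1 0 : ℤ) = 0 ∧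
      ((σ * (γ : SL(2, ℤ)) * σ⁻¹) 1 1 : ℤ) ^ 2 = 1 := by
  set x := latSharp k with hxdef
  set τ : SL(2, ℤ) := σ * (γ : SL(2, ℤ)) * σ⁻¹ with hτ
  have hx : actM σ (yTwo lam) = x := by rw [← hσ, actM_actM, inv_mul_cancel, actM_one]
  have key : γ • k = k ↔ actM τ⁻¹ (yTwo lam) = yTwo lam := by
    constructor
    · intro h
      have h1 : actM ((γ : SL(2, ℤ))⁻¹) x = x := by rw [← latSharp_smul_eq_actM, h]
      calc actM τ⁻¹ (yTwo lam) = actM τ⁻¹ (actM σ⁻¹ x) := by rw [hσ]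
        _ = actM (σ⁻¹ * τ⁻¹) x := actM_actM _ _ _
        _ = actM ((γ : SL(2, ℤ))⁻¹ * σ⁻¹) x := by rw [hτ]; congr 1; group
        _ = actM σ⁻¹ (actM (γ : SL(2, ℤ))⁻¹ x) := (actM_actM _ _ _).symm
        _ = actM σ⁻¹ x := by rw [h1]
        _ = yTwo lam := hσ
    · intro h
      have h1 : actM ((γ : SL(2, ℤ))⁻¹) x = x := by
        calc actM (γ : SL(2, ℤ))⁻¹ x = actM (γ : SL(2, ℤ))⁻¹ (actM σ (yTwo lam)) := by rw [hx]
          _ = actM (σ * (γ : SL(2, ℤ))⁻¹) (yTwo lam) := actM_actM _ _ _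
          _ = actM (τ⁻¹ * σ) (yTwo lam) := by rw [hτ]; congr 1; group
          _ = actM σ (actM τ⁻¹ (yTwo lam)) := (actM_actM _ _ _).symm
          _ = actM σ (yTwo lam) := by rw [h]
          _ = x := hx
      apply latSharp_injective
      rw [latSharp_smul_eq_actM, h1]
  rw [key, actM, yTwo, actV_Y2_eq_iff hlam]
  obtain ⟨i00, i01, i10, i11⟩ := inv_apply τ
  rw [i10, i11]
  have hdet := det_eq_one' τ
  constructor
  · rintro ⟨hc, hd⟩
    push_cast at hc
    have hc' : (τ 1 0 : ℤ) = 0 := by exact_mod_cast neg_eq_zero.mp hc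
    have ha : (τ 0 0 : ℤ) ^ 2 = 1 := by exact_mod_cast hd
    rw [hc', mul_zero, sub_zero] at hdet
    refine ⟨hc', ?_⟩
    have : ((τ 1 1 : ℤ)) ^ 2 - 1 = (τ 1 1 : ℤ) ^ 2 * (1 - (τ 0 0 : ℤ) ^ 2) := by nlinarith [hdet]
    nlinarith [this, ha]
  · rintro ⟨hc, hd⟩
    rw [hc, mul_zero, sub_zero] at hdet
    refine ⟨by rw [hc]; simp, ?_⟩
    have : (τ 0 0 : ℤ) ^ 2 = 1 := by
      have : ((τ 0 0 : ℤ)) ^ 2 - 1 = (τ 0 0 : ℤ) ^ 2 * (1 - (τ 1 1 : ℤ) ^ 2) := by nlinarith [hdet]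
      nlinarith [this, hd]
    exact_mod_cast this

/-- **Stabiliser elements are conjugate translations**: under the same hypothesis,
`γ • k = k` iff `σ γ σ⁻¹ = T^j` for some `j ∈ ℤ` (the case `-T^j` is excluded because
`Γ₀(64)⁺` has no elements of trace `-2`). [folklore] -/
theorem smul_eq_iff_exists_T_zpow {σ : SL(2, ℤ)} {lam : ℝ} (hlam : lam ≠ 0)
    (hσ : actM σ⁻¹ (latSharp k) = yTwo lam) (γ : Gamma0Plus 64) :
    γ • k = k ↔ ∃ j : ℤ, σ * (γ : SL(2, ℤ)) * σ⁻¹ = ModularGroup.T ^ j := by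
  rw [smul_eq_iff_conj hlam hσ]
  set τ : SL(2, ℤ) := σ * (γ : SL(2, ℤ)) * σ⁻¹ with hτ
  constructor
  · rintro ⟨hc, hd2⟩
    have hd : (τ 1 1 : ℤ) = 1 ∨ (τ 1 1 : ℤ) = -1 := by
      have : ((τ 1 1 : ℤ) - 1) * ((τ 1 1 : ℤ) + 1) = 0 := by ring_nf; linarith [hd2]
      rcases mul_eq_zero.mp this with h | h
      · left; linarith
      · right; linarith
    rcases hd with hd | hd
    · exact ⟨τ 0 1, eq_T_zpow_of_c_eq_zero hc hd⟩
    · exfalso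
      have hdet := det_eq_one' τ
      rw [hc, hd] at hdet
      have ha : (τ 0 0 : ℤ) = -1 := by linarith
      have htr : (τ 0 0 : ℤ) + τ 1 1 = -2 := by rw [ha, hd]; norm_num
      have hconj := trace_conj σ (γ : SL(2, ℤ))
      rw [← hτ] at hconj
      exact trace_ne_neg_two γ (by linarith)
  · rintro ⟨j, hj⟩
    rw [hj, ModularGroup.coe_T_zpow]
    simp

/-- The additive subgroup `J(σ) = {j : σ⁻¹ T^j σ ∈ Γ₀(64)⁺}` of `ℤ`. [folklore] -/
def jSubgroup (σ : SL(2, ℤ)) : AddSubgroup ℤ where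
  carrier := {j | σ⁻¹ * ModularGroup.T ^ j * σ ∈ Gamma0Plus 64}
  zero_mem' := by
    show σ⁻¹ * ModularGroup.T ^ (0 : ℤ) * σ ∈ Gamma0Plus 64
    rw [zpow_zero, mul_one, inv_mul_cancel]
    exact (Gamma0Plus 64).one_mem
  add_mem' := by
    intro a b ha hb
    simp only [Set.mem_setOf_eq] at ha hb ⊢
    have : σ⁻¹ * ModularGroup.T ^ (a + b) * σ = (σ⁻¹ * ModularGroup.T ^ a * σ) * (σ⁻¹ * ModularGroup.T ^ b * σ) := by
      rw [_root_.zpow_add]; group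
    rw [this]
    exact (Gamma0Plus 64).mul_mem ha hb
  neg_mem' := by
    intro a ha
    simp only [Set.mem_setOf_eq] at ha ⊢
    have : σ⁻¹ * ModularGroup.T ^ (-a) * σ = (σ⁻¹ * ModularGroup.T ^ a * σ)⁻¹ := by
      rw [_root_.zpow_neg]; group
    rw [this]
    exact (Gamma0Plus 64).inv_mem ha

/-- Membership in `J(σ)`. [folklore] -/
theorem mem_jSubgroup {σ : SL(2, ℤ)} {j : ℤ} :
    j ∈ jSubgroup σ ↔ σ⁻¹ * ModularGroup.T ^ j * σ ∈ Gamma0Plus 64 := Iff.rfl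

/-- `J(σ)` contains a positive integer (`Γ₀(64)⁺` has finite index in `SL₂(ℤ)`). [folklore] -/
theorem exists_pos_mem_jSubgroup (σ : SL(2, ℤ)) : ∃ n : ℤ, 0 < n ∧ n ∈ jSubgroup σ := by
  have hidx : (Gamma0Plus 64).index ≠ 0 := Subgroup.FiniteIndex.index_ne_zero
  have hpow : ∀ n : ℕ, σ⁻¹ * ModularGroup.T ^ (n : ℤ) * σ = (σ⁻¹ * ModularGroup.T * σ) ^ n := by
    intro n
    induction n with
    | zero => simp
    | succ m ih =>
      rw [pow_succ, ← ih, Nat.cast_succ, _root_.zpow_add_one]; group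
  obtain ⟨n, hn, -, hmem⟩ := Subgroup.exists_pow_mem_of_index_ne_zero hidx (σ⁻¹ * ModularGroup.T * σ)
  refine ⟨n, by exact_mod_cast hn, ?_⟩
  rw [mem_jSubgroup, hpow n]
  exact hmem

/-- **`J(σ) = n₀ ℤ` with `n₀ > 0`.** [folklore] -/
theorem exists_generator_jSubgroup (σ : SL(2, ℤ)) :
    ∃ n₀ : ℕ, 0 < n₀ ∧ ∀ j : ℤ, j ∈ jSubgroup σ ↔ (n₀ : ℤ) ∣ j := by
  obtain ⟨a, ha⟩ := Int.subgroup_cyclic (jSubgroup σ)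
  obtain ⟨n, hnpos, hn⟩ := exists_pos_mem_jSubgroup σ
  have hmem : ∀ j : ℤ, j ∈ jSubgroup σ ↔ a ∣ j := by
    intro j
    rw [ha, ← AddSubgroup.zmultiples_eq_closure, Int.mem_zmultiples_iff]
  have ha0 : a ≠ 0 := by
    intro h0
    have := (hmem n).mp hn
    rw [h0, zero_dvd_iff] at this
    omega
  refine ⟨a.natAbs, Int.natAbs_pos.mpr ha0, fun j ↦ ?_⟩
  rw [hmem, Int.natAbs_dvd]

/-- **The structure of the stabiliser of a non-zero null vector in `Γ₀(64)⁺`.**  There are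
`σ ∈ SL₂(ℤ)` with `ι♮(k) ∘ σ⁻¹ = λ Y²` (`λ ≠ 0`), an integer `n₀ > 0` and a bijection
`m : Γ_k → ℤ` such that every `γ ∈ Γ_k` acts through `σ(γ w) = (n₀ m(γ)) +ᵥ σ w`; moreover
`σ⁻¹ T^{n₀} σ ∈ Γ₀(64)⁺`.  (So `Γ_k` is infinite cyclic, generated by a conjugate translation.)
[cite: Shintani1975, §2, proof of Prop. 2.3 (p. 103)] -/
theorem null_stabilizer (hnull : disc (latSharp k) = 0) (hk : k ≠ 0) :
    ∃ (σ : SL(2, ℤ)) (lam : ℝ) (n₀ : ℕ) (m : MulAction.stabilizer (Gamma0Plus 64) k → ℤ),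
      lam ≠ 0 ∧ 0 < n₀ ∧ actM σ⁻¹ (latSharp k) = yTwo lam ∧ Function.Bijective m ∧
      (∀ (γ : MulAction.stabilizer (Gamma0Plus 64) k) (w : ℍ),
        σ • (((γ : Gamma0Plus 64) : SL(2, ℤ)) • w) = (((n₀ : ℤ) * m γ : ℤ) : ℝ) +ᵥ (σ • w)) ∧
      σ⁻¹ * ModularGroup.T ^ (n₀ : ℤ) * σ ∈ Gamma0Plus 64 := by
  obtain ⟨σ, lam, hlam, hσ'⟩ := exists_conj_to_yTwo hnull hk
  have hσ : actM σ⁻¹ (latSharp k) = yTwo lam := hσ'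
  obtain ⟨n₀, hn₀, hJ⟩ := exists_generator_jSubgroup σ
  -- `j(γ)`: the translation amount of `σ γ σ⁻¹ = T^{j(γ)}`
  have hstab : ∀ γ : MulAction.stabilizer (Gamma0Plus 64) k,
      σ * ((γ : Gamma0Plus 64) : SL(2, ℤ)) * σ⁻¹ =
        ModularGroup.T ^ ((σ * ((γ : Gamma0Plus 64) : SL(2, ℤ)) * σ⁻¹) 0 1 : ℤ) := by
    intro γ
    have hfix : (γ : Gamma0Plus 64) • k = k := γ.2
    obtain ⟨j, hj⟩ := (smul_eq_iff_exists_T_zpow hlam hσ (γ : Gamma0Plus 64)).mp hfix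
    rw [hj, ModularGroup.coe_T_zpow]
    simp
  have hdvd : ∀ γ : MulAction.stabilizer (Gamma0Plus 64) k,
      (n₀ : ℤ) ∣ ((σ * ((γ : Gamma0Plus 64) : SL(2, ℤ)) * σ⁻¹) 0 1 : ℤ) := by
    intro γ
    rw [← hJ, mem_jSubgroup, ← hstab γ]
    have : σ⁻¹ * (σ * ((γ : Gamma0Plus 64) : SL(2, ℤ)) * σ⁻¹) * σ = ((γ : Gamma0Plus 64) : SL(2, ℤ)) := by group
    rw [this]
    exact (γ : Gamma0Plus 64).2
  set m : MulAction.stabilizer (Gamma0Plus 64) k → ℤ :=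
    fun γ ↦ ((σ * ((γ : Gamma0Plus 64) : SL(2, ℤ)) * σ⁻¹) 0 1 : ℤ) / n₀ with hm
  have hmul : ∀ γ, (n₀ : ℤ) * m γ = ((σ * ((γ : Gamma0Plus 64) : SL(2, ℤ)) * σ⁻¹) 0 1 : ℤ) :=
    fun γ ↦ Int.mul_ediv_cancel' (hdvd γ)
  refine ⟨σ, lam, n₀, m, hlam, hn₀, hσ, ⟨?_, ?_⟩, ?_, (hJ n₀).mpr (dvd_refl _)⟩
  · -- injective
    intro γ γ' h
    have h1 : σ * ((γ : Gamma0Plus 64) : SL(2, ℤ)) * σ⁻¹ = σ * ((γ' : Gamma0Plus 64) : SL(2, ℤ)) * σ⁻¹ := by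
      rw [hstab γ, hstab γ', ← hmul γ, ← hmul γ', h]
    have h2 : ((γ : Gamma0Plus 64) : SL(2, ℤ)) = ((γ' : Gamma0Plus 64) : SL(2, ℤ)) := by
      have := congrArg (fun t ↦ σ⁻¹ * t * σ) h1
      simpa [mul_assoc] using this
    exact Subtype.ext (Subtype.ext h2)
  · -- surjective
    intro i
    have hmemJ : (n₀ : ℤ) * i ∈ jSubgroup σ := (hJ _).mpr (dvd_mul_right _ _)
    rw [mem_jSubgroup] at hmemJ
    set g : SL(2, ℤ) := σ⁻¹ * ModularGroup.T ^ ((n₀ : ℤ) * i) * σ with hg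
    have hfix : (⟨g, hmemJ⟩ : Gamma0Plus 64) • k = k := by
      rw [smul_eq_iff_exists_T_zpow hlam hσ]
      exact ⟨(n₀ : ℤ) * i, by rw [Subgroup.coe_mk, hg]; group⟩
    refine ⟨⟨⟨g, hmemJ⟩, hfix⟩, ?_⟩
    show ((σ * g * σ⁻¹) 0 1 : ℤ) / n₀ = i
    have : σ * g * σ⁻¹ = ModularGroup.T ^ ((n₀ : ℤ) * i) := by rw [hg]; group
    rw [this, ModularGroup.coe_T_zpow]
    simp only [Matrix.of_apply, Matrix.cons_val', Matrix.cons_val_one, Matrix.cons_val_fin_one,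
      Matrix.cons_val_zero]
    have hn0 : (n₀ : ℤ) ≠ 0 := by exact_mod_cast hn₀.ne'
    exact Int.mul_ediv_cancel_left _ hn0
  · -- the action formula
    intro γ w
    have h1 : σ • (((γ : Gamma0Plus 64) : SL(2, ℤ)) • w) = (σ * ((γ : Gamma0Plus 64) : SL(2, ℤ)) * σ⁻¹) • (σ • w) := by
      rw [← mul_smul, ← mul_smul]; congr 1; group
    rw [h1, hstab γ, ← hmul γ, UpperHalfPlane.modular_T_zpow_smul]

end Literature.NumberTheory.EllipticCurves.Shintani
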